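import Summits.Ventures.PercRepro.CoreFiveCounts
import Summits.Ventures.PercRepro.CoreFourSmall

/-!
# PercRepro — the corank-`5` core cells `9 ≤ p ≤ 13` (p2, gen 12)

The method of `CoreFourSmall` at corank `5` (`n = |E| = p + 5 ∈ [14, 18]`), with the plane count of `CoreFiveCounts`
(`#{sets of rank ≤ 3 with ≥ 5 points} ≤ s₄ + 29`) on both sides of `Φ(p,3)·#U(p,3) ≤ #Y(p,3)`:

* `ν(S₀) ≤ 4` (`rls_five_of_nullity_le_four`): `s₃ ≤ 16` (TriangleStar on `S₀`), `s₄ ≤ 35` (the cocircuit count at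
  nullity `≤ 4` on `≤ 20` elements) — ratios `0.88, 0.77, 0.68, 0.61, 0.56`;
* `ν(S₀) = 5` (`rls_five_of_dense`): `S₀ = E`, series classes of `≤ 4` elements, the class-structure bounds and the
  cocircuit count with the exact number of classes at nullity `5` (and `s₃ ≤ 25`, `s₄ ≤ 70`): every class-size vector
  passes by kernel evaluation (`table_dense5_14` … `table_dense5_18`; worst `0.980` at `n = 14`, all classes singletons).

* `cellOK5`, `cellOK5_spec`, **`rls_of_cellOK5`** — the cell inequality and its meaning;
* **`c025_core_five_small`** — the cells `9 ≤ p ≤ 13` at corank `5`;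
* `SmallCoreCellsSix`, `smallCoreCells''''_of_six`, **`c025_three_of_smallCoreCellsSix`** — the `q = 3` row from the
  cells without corank `4` below `p = 18` and without corank `5` below `p = 14`.
Imports `CoreFiveCounts`, `CoreFourSmall`. Axioms: standard.
-/

namespace PercRepro
namespace CoreFour

open Finset Set

/-! ### The cell predicate at corank `5` -/

/-- The corank-`5` cell at `n = |E|` with bounds `s₃`, `s₄`: in `ℕ`, multiplied by `C(p+3,3)` (`p = n − 5`),
`phiNum·U + C(p+3,3)·(R + S) ≤ C(p+3,3)·2ⁿ` with `U = C(n,3) + s₃(n−3) + s₄ + (s₄ + 29)`,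
`R = Σ_{j<4} C(n,j) + s₃(n−3) + s₄ + (s₄ + 29)`, `S = Σ_{j<6} C(n,j)`. -/
def cellOK5 (n s₃ s₄ : ℕ) : Bool :=
  let p := n - 5
  let phiNum := 2 ^ (p + 3) - 2 * ∑ u ∈ range 4, CoreRegimes.chooseF (p + 3) u
  let phiDen := CoreRegimes.chooseF (p + 3) 3
  let U := CoreRegimes.chooseF n 3 + (s₃ * (n - 3) + s₄) + (s₄ + 29)
  let R := (∑ j ∈ range 4, CoreRegimes.chooseF n j) + (s₃ * (n - 3) + s₄) + (s₄ + 29)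
  let S := ∑ j ∈ range 6, CoreRegimes.chooseF n j
  decide (phiNum * U + phiDen * (R + S) ≤ phiDen * 2 ^ n)

/-- The inequality behind `cellOK5`, in `ℕ` with ordinary binomials. -/
theorem cellOK5_spec {n s₃ s₄ : ℕ} (h : cellOK5 n s₃ s₄ = true) :
    (2 ^ (n - 5 + 3) - 2 * ∑ u ∈ range 4, Nat.choose (n - 5 + 3) u) *
        (n.choose 3 + (s₃ * (n - 3) + s₄) + (s₄ + 29)) +
      Nat.choose (n - 5 + 3) 3 * (((∑ j ∈ range 4, n.choose j) + (s₃ * (n - 3) + s₄) + (s₄ + 29)) +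
        ∑ j ∈ range 6, n.choose j) ≤ Nat.choose (n - 5 + 3) 3 * 2 ^ n := by
  unfold cellOK5 at h
  simp only [CoreRegimes.chooseF_eq] at h
  exact of_decide_eq_true h

variable {α : Type} {M : Matroid α}

/-- **A kernel-evaluated corank-`5` cell gives C-025 at `(p, 3)` on the coloop-free core**, `p ≥ 9`, `|E| = p + 5`,
given `#{3-circuits} ≤ s₃` and `#{4-circuits} ≤ s₄`. -/
theorem rls_of_cellOK5 (M : Matroid α) [M.Finite] (p : ℕ) (hp : 9 ≤ p)
    (hs : ∀ e ∈ M.E, ∀ f ∈ M.E, e ≠ f → M.eRk {e, f} = 2)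
    (hC1 : ∀ L ⊆ M.E, M.eRk L = 2 → L.ncard ≤ 3) (hC2 : ∀ P ⊆ M.E, M.eRk P = 3 → P.ncard ≤ 7)
    (hcoloop : ∀ e, ¬ M.IsColoop e) (hrank : M.eRank = (p : ℕ∞)) (hE : M.E.ncard = p + 5)
    {s₃ s₄ : ℕ} (hs₃ : (PercRepro.Matroid.circuitsEq M 3).ncard ≤ s₃)
    (hs₄ : (PercRepro.Matroid.circuitsEq M 4).ncard ≤ s₄)
    (hcell : cellOK5 (p + 5) s₃ s₄ = true) : ThmN.RLS M p 3 := by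
  classical
  have hEcard : M.ground_finite.toFinset.card = p + 5 := by
    rw [← hE, Set.ncard_eq_toFinset_card _ M.ground_finite]
  have hd : M.E.encard = M.eRank + 5 := by
    rw [hrank, ← M.ground_finite.cast_ncard_eq, hE]; push_cast; rfl
  have hrank2 : 2 ≤ M.eRank := by rw [hrank]; exact_mod_cast (show 2 ≤ p by omega)
  -- the four-sets and the big sets
  have h4 : {X : Set α | X ⊆ M.E ∧ X.ncard = 4 ∧ M.eRk X ≤ 3}.ncard ≤ s₃ * (p + 5 - 3) + s₄ := by
    have h := ncard_four_sets_le hs hrank2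
    rw [hE] at h
    have h' : (PercRepro.Matroid.circuitsEq M 3).ncard * (p + 5 - 3) ≤ s₃ * (p + 5 - 3) :=
      Nat.mul_le_mul_right _ hs₃
    omega
  have hbig : {X : Set α | X ⊆ M.E ∧ M.eRk X ≤ 3 ∧ 5 ≤ X.ncard}.ncard ≤ s₄ + 29 := by
    have h := ncard_big_sets_le hs hC1 hC2 hcoloop hd (by norm_num) hrank (by omega)
    omega
  -- (U)
  have hU : Matroid.topCount M p 3 ≤ (p + 5).choose 3 + (s₃ * (p + 5 - 3) + s₄) + (s₄ + 29) := by
    have h := topCount_le_five hd hrank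
    rw [hE] at h
    omega
  -- (R)
  have hR : {X : Set α | X ⊆ M.E ∧ M.eRk X ≤ 3}.ncard ≤
      (∑ j ∈ range 4, (p + 5).choose j) + (s₃ * (p + 5 - 3) + s₄) + (s₄ + 29) := by
    have h := ncard_eRk_le_three_le_general (M := M)
    rw [hE] at h
    omega
  -- (S)
  have hS : {X : Set α | X ⊆ M.E ∧ M.eRk X = M.eRank}.ncard ≤ ∑ j ∈ range 6, (p + 5).choose j := by
    have h := PercRepro.Matroid.ncard_spanning_le (M := M) (d := 5) hd
    rw [hEcard] at h
    exact h
  -- (Y)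
  have hY : 2 ^ (p + 5) ≤ Matroid.midCount M p 3 + {X : Set α | X ⊆ M.E ∧ M.eRk X ≤ 3}.ncard +
      {X : Set α | X ⊆ M.E ∧ M.eRk X = M.eRank}.ncard := by
    have h := PercRepro.Matroid.two_pow_le_midCount_add (M := M) p 3 hrank
    rw [hEcard] at h
    exact h
  -- the cell
  have hcell' := cellOK5_spec hcell
  rw [Nat.add_sub_cancel] at hcell'
  obtain ⟨phiNum, hphiNum⟩ : ∃ x, x = 2 ^ (p + 3) - 2 * ∑ u ∈ range 4, Nat.choose (p + 3) u := ⟨_, rfl⟩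
  obtain ⟨phiDen, hphiDen⟩ : ∃ x, x = Nat.choose (p + 3) 3 := ⟨_, rfl⟩
  obtain ⟨U, hU_def⟩ : ∃ x, x = (p + 5).choose 3 + (s₃ * (p + 5 - 3) + s₄) + (s₄ + 29) := ⟨_, rfl⟩
  obtain ⟨R, hR_def⟩ : ∃ x, x = (∑ j ∈ range 4, (p + 5).choose j) + (s₃ * (p + 5 - 3) + s₄) + (s₄ + 29) :=
    ⟨_, rfl⟩
  obtain ⟨S, hS_def⟩ : ∃ x, x = ∑ j ∈ range 6, (p + 5).choose j := ⟨_, rfl⟩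
  rw [← hphiNum, ← hphiDen, ← hU_def, ← hR_def, ← hS_def] at hcell'
  rw [← hU_def] at hU
  rw [← hR_def] at hR
  rw [← hS_def] at hS
  have hUq : (Matroid.topCount M p 3 : ℚ) ≤ (U : ℚ) := by exact_mod_cast hU
  have hRq : ({X : Set α | X ⊆ M.E ∧ M.eRk X ≤ 3}.ncard : ℚ) ≤ (R : ℚ) := by exact_mod_cast hR
  have hSq : ({X : Set α | X ⊆ M.E ∧ M.eRk X = M.eRank}.ncard : ℚ) ≤ (S : ℚ) := by exact_mod_cast hS
  have hYq : ((2 : ℕ) ^ (p + 5) : ℚ) ≤ (Matroid.midCount M p 3 : ℚ) +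
      ({X : Set α | X ⊆ M.E ∧ M.eRk X ≤ 3}.ncard : ℚ) +
      ({X : Set α | X ⊆ M.E ∧ M.eRk X = M.eRank}.ncard : ℚ) := by exact_mod_cast hY
  have hcellq : (phiNum : ℚ) * (U : ℚ) + (phiDen : ℚ) * ((R : ℚ) + (S : ℚ)) ≤
      (phiDen : ℚ) * ((2 : ℕ) ^ (p + 5) : ℚ) := by exact_mod_cast hcell'
  have hsub : 2 * ∑ u ∈ range 4, Nat.choose (p + 3) u ≤ 2 ^ (p + 3) := by
    have := CoreRegimes.sum_Ioo_choose_add p (by omega); omega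
  have hphi : phiK p 3 * (phiDen : ℚ) = (phiNum : ℚ) := by
    rw [hphiNum, Nat.cast_sub hsub, hphiDen]
    push_cast
    exact CoreRegimes.phiK_three_mul_choose_eq p (by omega)
  have hDpos : (0 : ℚ) < (phiDen : ℚ) := by
    rw [hphiDen]; exact_mod_cast Nat.choose_pos (by omega)
  have hNnn : (0 : ℚ) ≤ (phiNum : ℚ) := by positivity
  have h1 : (phiNum : ℚ) * (Matroid.topCount M p 3 : ℚ) ≤ (phiNum : ℚ) * (U : ℚ) :=
    mul_le_mul_of_nonneg_left hUq hNnn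
  have h2 : (phiDen : ℚ) * ((2 : ℕ) ^ (p + 5) : ℚ) ≤
      (phiDen : ℚ) * ((Matroid.midCount M p 3 : ℚ) + (R : ℚ) + (S : ℚ)) :=
    mul_le_mul_of_nonneg_left (by linarith) hDpos.le
  have hkey : (phiNum : ℚ) * (Matroid.topCount M p 3 : ℚ) ≤ (phiDen : ℚ) * (Matroid.midCount M p 3 : ℚ) := by
    nlinarith [h1, h2, hcellq]
  rw [ThmN.RLS_iff]
  rw [← hphi] at hkey
  have : phiK p 3 * (Matroid.topCount M p 3 : ℚ) * (phiDen : ℚ) ≤ (Matroid.midCount M p 3 : ℚ) * (phiDen : ℚ) := by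
    calc phiK p 3 * (Matroid.topCount M p 3 : ℚ) * (phiDen : ℚ)
        = phiK p 3 * (phiDen : ℚ) * (Matroid.topCount M p 3 : ℚ) := by ring
      _ ≤ (phiDen : ℚ) * (Matroid.midCount M p 3 : ℚ) := hkey
      _ = (Matroid.midCount M p 3 : ℚ) * (phiDen : ℚ) := by ring
  exact le_of_mul_le_mul_right this hDpos

/-! ### Case A: `ν(S₀) ≤ 4` -/

/-- The cells `n = 14, …, 18` with `s₃ = 16`, `s₄ = 35`. -/
theorem table_sparse5 : ∀ n < 19, 14 ≤ n → cellOK5 n 16 35 = true := by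
  decide +kernel

/-- **Case A at corank `5`**: `ν(S₀) ≤ 4`. -/
theorem rls_five_of_nullity_le_four (M : Matroid α) [M.Finite] (p : ℕ) (hp : 9 ≤ p) (hp' : p ≤ 13)
    (hs : ∀ e ∈ M.E, ∀ f ∈ M.E, e ≠ f → M.eRk {e, f} = 2)
    (hfree : ∀ e ∈ M.E, ∃ A ⊆ M.E \ {e}, e ∉ M.closure A ∧ e ∉ M.closure ((M.E \ {e}) \ A))
    (hcoloop : ∀ e, ¬ M.IsColoop e) (hrank : M.eRank = (p : ℕ∞)) (hE : M.E.ncard = p + 5)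
    {d' : ℕ} (hd' : (⋃₀ PercRepro.Matroid.circuitsLE M 4).encard = M.eRk (⋃₀ PercRepro.Matroid.circuitsLE M 4) + d')
    (hd4 : d' ≤ 4) : ThmN.RLS M p 3 := by
  have hC1 : ∀ L ⊆ M.E, M.eRk L = 2 → L.ncard ≤ 3 :=
    fun L hL hr => ThmN.ncard_le_three_of_eRk_two M hs hfree hL hr
  have hC2 : ∀ P ⊆ M.E, M.eRk P = 3 → P.ncard ≤ 7 :=
    fun P hP hr => ThmN.ncard_le_seven_of_eRk_three M hs hfree hP hr
  have hd : M.E.encard = M.eRank + 5 := by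
    rw [hrank, ← M.ground_finite.cast_ncard_eq, hE]; push_cast; rfl
  have hS₀E : ⋃₀ PercRepro.Matroid.circuitsLE M 4 ⊆ M.E := sUnion_circuitsLE_subset_ground M 4
  have hS20 : (⋃₀ PercRepro.Matroid.circuitsLE M 4).ncard ≤ 20 := by
    have hfin : (⋃₀ PercRepro.Matroid.circuitsLE M 4).Finite := M.ground_finite.subset hS₀E
    have h := PercRepro.Matroid.encard_sUnion_circuitsLE_le (M := M) (k := 4) (d := 5) hd
    rw [← hfin.cast_ncard_eq] at h
    exact_mod_cast h
  have hs₃ : (PercRepro.Matroid.circuitsEq M 3).ncard ≤ 16 := by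
    have h := ThmN.core_ncard_triangles_subset_le_sq M hs hfree hS₀E hd'
    have hsub : PercRepro.Matroid.circuitsEq M 3 ⊆
        {C : Set α | M.IsCircuit C ∧ C.ncard = 3 ∧ C ⊆ ⋃₀ PercRepro.Matroid.circuitsLE M 4} := by
      intro C hC
      exact ⟨hC.1, hC.2, Set.subset_sUnion_of_mem (PercRepro.Matroid.circuitsEq_subset_circuitsLE (by norm_num) hC)⟩
    have hfin : {C : Set α | M.IsCircuit C ∧ C.ncard = 3 ∧ C ⊆ ⋃₀ PercRepro.Matroid.circuitsLE M 4}.Finite :=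
      M.ground_finite.finite_subsets.subset (fun C hC => hC.1.subset_ground)
    calc (PercRepro.Matroid.circuitsEq M 3).ncard ≤ _ := Set.ncard_le_ncard hsub hfin
      _ ≤ d' * d' := h
      _ ≤ 16 := Nat.mul_le_mul hd4 hd4
  have hs₄ : (PercRepro.Matroid.circuitsEq M 4).ncard ≤ 35 :=
    ncard_isCircuit_four_le_of_subset_nullity_le_four' M hS₀E
      (fun C hC h4 => subset_sUnion_of_mem_circuitsEq_four ⟨hC, h4⟩) hS20
      (by rw [hd']; gcongr; exact_mod_cast hd4)
  exact rls_of_cellOK5 M p hp hs hC1 hC2 hcoloop hrank hE hs₃ hs₄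
    (table_sparse5 (p + 5) (by omega) (by omega))

/-! ### Case B: `S₀ = E` -/

/-- The cocircuit count at nullity `5`: `#{k-circuits} ≤ C(c, 4) / C(c − k − 4 + 2, 2)`. -/
def lm5 (c k : ℕ) : ℕ := c.choose 4 / (c - k - 4 + 2).choose 2

/-- The count `s · C(c − k − 2, 2) ≤ C(c, 4)` read as the bound `s ≤ lm5 c k`. -/
theorem le_lm5_of_mul_le {s c k : ℕ} (h : s * (c - k - 4 + 2).choose 2 ≤ c.choose 4) : s ≤ lm5 c k := by
  unfold lm5
  rw [Nat.le_div_iff_mul_le (Nat.choose_pos (by omega))]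
  exact h

/-- The bound on `s₃` from the class-size vector at nullity `5` (with `s₃ ≤ 25`). -/
def bound3five (σ t₂ t₃ t₄ : ℕ) : ℕ :=
  min 25 (min (lm5 (σ + t₂ + t₃ + t₄) 3) (σ.choose 3 + σ * t₂ + t₃))

/-- The bound on `s₄` from the class-size vector at nullity `5` (with `s₄ ≤ 70`). -/
def bound4five (σ t₂ t₃ t₄ : ℕ) : ℕ :=
  min 70 (min (lm5 (σ + t₂ + t₃ + t₄) 4) (σ.choose 4 + σ.choose 2 * t₂ + t₂.choose 2 + σ * t₃ + t₄))

/-- The dense case at corank `5`, `n = 14`: every class-size vector `(σ, t₂, t₃, t₄)` with `σ + 2t₂ + 3t₃ + 4t₄ = 14`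
passes the cell with the bounds `bound3five` / `bound4five` (by `decide +kernel`). -/
theorem table_dense5_14 : ∀ σ < 15, ∀ t₂ < 8, ∀ t₃ < 5, ∀ t₄ < 4, σ + 2 * t₂ + 3 * t₃ + 4 * t₄ = 14 →
    cellOK5 14 (bound3five σ t₂ t₃ t₄) (bound4five σ t₂ t₃ t₄) = true := by
  decide +kernel

/-- The dense case at corank `5`, `n = 15` (by `decide +kernel`). -/
theorem table_dense5_15 : ∀ σ < 16, ∀ t₂ < 8, ∀ t₃ < 6, ∀ t₄ < 4, σ + 2 * t₂ + 3 * t₃ + 4 * t₄ = 15 →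
    cellOK5 15 (bound3five σ t₂ t₃ t₄) (bound4five σ t₂ t₃ t₄) = true := by
  decide +kernel

/-- The dense case at corank `5`, `n = 16` (by `decide +kernel`). -/
theorem table_dense5_16 : ∀ σ < 17, ∀ t₂ < 9, ∀ t₃ < 6, ∀ t₄ < 5, σ + 2 * t₂ + 3 * t₃ + 4 * t₄ = 16 →
    cellOK5 16 (bound3five σ t₂ t₃ t₄) (bound4five σ t₂ t₃ t₄) = true := by
  decide +kernel

/-- The dense case at corank `5`, `n = 17` (by `decide +kernel`). -/
theorem table_dense5_17 : ∀ σ < 18, ∀ t₂ < 9, ∀ t₃ < 6, ∀ t₄ < 5, σ + 2 * t₂ + 3 * t₃ + 4 * t₄ = 17 →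
    cellOK5 17 (bound3five σ t₂ t₃ t₄) (bound4five σ t₂ t₃ t₄) = true := by
  decide +kernel

/-- The dense case at corank `5`, `n = 18` (by `decide +kernel`). -/
theorem table_dense5_18 : ∀ σ < 19, ∀ t₂ < 10, ∀ t₃ < 7, ∀ t₄ < 5, σ + 2 * t₂ + 3 * t₃ + 4 * t₄ = 18 →
    cellOK5 18 (bound3five σ t₂ t₃ t₄) (bound4five σ t₂ t₃ t₄) = true := by
  decide +kernel

/-- The dense tables, gathered. -/
theorem table_dense5 (n : ℕ) (hn : 14 ≤ n) (hn' : n ≤ 18) (σ t₂ t₃ t₄ : ℕ)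
    (h : σ + 2 * t₂ + 3 * t₃ + 4 * t₄ = n) :
    cellOK5 n (bound3five σ t₂ t₃ t₄) (bound4five σ t₂ t₃ t₄) = true := by
  rcases (show n = 14 ∨ n = 15 ∨ n = 16 ∨ n = 17 ∨ n = 18 by omega) with rfl | rfl | rfl | rfl | rfl
  · exact table_dense5_14 σ (by omega) t₂ (by omega) t₃ (by omega) t₄ (by omega) h
  · exact table_dense5_15 σ (by omega) t₂ (by omega) t₃ (by omega) t₄ (by omega) h
  · exact table_dense5_16 σ (by omega) t₂ (by omega) t₃ (by omega) t₄ (by omega) h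
  · exact table_dense5_17 σ (by omega) t₂ (by omega) t₃ (by omega) t₄ (by omega) h
  · exact table_dense5_18 σ (by omega) t₂ (by omega) t₃ (by omega) t₄ (by omega) h

/-- **Case B at corank `5`**: `S₀ = E`. -/
theorem rls_five_of_dense (M : Matroid α) [M.Finite] (p : ℕ) (hp : 9 ≤ p) (hp' : p ≤ 13)
    (hs : ∀ e ∈ M.E, ∀ f ∈ M.E, e ≠ f → M.eRk {e, f} = 2)
    (hfree : ∀ e ∈ M.E, ∃ A ⊆ M.E \ {e}, e ∉ M.closure A ∧ e ∉ M.closure ((M.E \ {e}) \ A))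
    (hcoloop : ∀ e, ¬ M.IsColoop e) (hrank : M.eRank = (p : ℕ∞)) (hE : M.E.ncard = p + 5)
    (hS₀ : ⋃₀ PercRepro.Matroid.circuitsLE M 4 = M.E) : ThmN.RLS M p 3 := by
  classical
  have hC1 : ∀ L ⊆ M.E, M.eRk L = 2 → L.ncard ≤ 3 :=
    fun L hL hr => ThmN.ncard_le_three_of_eRk_two M hs hfree hL hr
  have hC2 : ∀ P ⊆ M.E, M.eRk P = 3 → P.ncard ≤ 7 :=
    fun P hP hr => ThmN.ncard_le_seven_of_eRk_three M hs hfree hP hr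
  have hd : M.E.encard = M.eRank + 5 := by
    rw [hrank, ← M.ground_finite.cast_ncard_eq, hE]; push_cast; rfl
  have hν : M✶.eRank = 5 := by
    have h := Matroid.eRank_add_eRank_dual M
    rw [hd, hrank] at h
    exact WithTop.add_left_cancel (WithTop.natCast_ne_top p) h
  -- the global bounds `s₃ ≤ 25`, `s₄ ≤ 70`
  have hs25 : (PercRepro.Matroid.circuitsEq M 3).ncard ≤ 25 := by
    have h := ThmN.ncard_triangles_le_sq M hC1 hd
    exact h
  have hs70 : (PercRepro.Matroid.circuitsEq M 4).ncard ≤ 70 := by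
    have hS₀E : ⋃₀ PercRepro.Matroid.circuitsLE M 4 ⊆ M.E := sUnion_circuitsLE_subset_ground M 4
    have hS20 : (⋃₀ PercRepro.Matroid.circuitsLE M 4).ncard ≤ 20 := by
      have hfin : (⋃₀ PercRepro.Matroid.circuitsLE M 4).Finite := M.ground_finite.subset hS₀E
      have h := PercRepro.Matroid.encard_sUnion_circuitsLE_le (M := M) (k := 4) (d := 5) hd
      rw [← hfin.cast_ncard_eq] at h
      exact_mod_cast h
    exact PercRepro.Matroid.ncard_isCircuit_four_le_of_subset_nullity_le_five M hS₀E
      (fun C hC h4 => subset_sUnion_of_mem_circuitsEq_four ⟨hC, h4⟩) hS20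
      (encard_le_eRk_add_of_ground hS₀E hd)
  -- representatives of the series classes
  obtain ⟨R, hR⟩ := exists_isReps M
  have hRfin : R.Finite := M.ground_finite.subset hR.subset
  set Rf := hRfin.toFinset with hRf
  set a : α → ℕ := fun r => (M✶.closure {r}).ncard with ha
  have hRc : R.ncard = Rf.card := Set.ncard_eq_toFinset_card _ _
  have h1 : ∀ r ∈ Rf, 1 ≤ a r := by
    intro r hr
    rw [hRf, Set.Finite.mem_toFinset] at hr
    have hfin := cls_finite (M := M) r
    exact Nat.one_le_iff_ne_zero.2 (fun h0 => by
      have := (Set.ncard_eq_zero hfin).1 h0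
      exact (Set.eq_empty_iff_forall_notMem.1 this r) (mem_cls_self hR hr))
  have h4 : ∀ r ∈ Rf, a r ≤ 4 := by
    intro r hr
    rw [hRf, Set.Finite.mem_toFinset] at hr
    have hrE : r ∈ ⋃₀ PercRepro.Matroid.circuitsLE M 4 := by rw [hS₀]; exact hR.subset hr
    obtain ⟨C, hC, hrC⟩ := Set.mem_sUnion.1 hrE
    have hsub := closure_dual_singleton_subset_of_mem_isCircuit hcoloop hC.1 hrC
    have hCfin : C.Finite := M.ground_finite.subset hC.1.subset_ground
    have hC4 : C.ncard ≤ 4 := by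
      have := hC.2
      rw [← hCfin.cast_ncard_eq] at this
      exact_mod_cast this
    exact (Set.ncard_le_ncard hsub hCfin).trans hC4
  set σ := (Rf.filter (fun r => a r = 1)).card with hσ
  set t₂ := (Rf.filter (fun r => a r = 2)).card with ht₂
  set t₃ := (Rf.filter (fun r => a r = 3)).card with ht₃
  set t₄ := (Rf.filter (fun r => a r = 4)).card with ht₄
  have hn : p + 5 = σ + 2 * t₂ + 3 * t₃ + 4 * t₄ := by
    rw [← hE, ncard_ground_eq_sum hcoloop hR hRfin, ← hRf]
    exact sum_eq_of_le_four Rf a h1 h4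
  have hc : Rf.card = σ + t₂ + t₃ + t₄ := card_eq_of_le_four Rf a h1 h4
  have hlm3 : (PercRepro.Matroid.circuitsEq M 3).ncard ≤ lm5 (σ + t₂ + t₃ + t₄) 3 := by
    have h := PercRepro.Matroid.ncard_isCircuit_mul_choose_le M hR.subset hR.nonloop hR.cover hR.inj hν 3
    rw [hRc, hc] at h
    exact le_lm5_of_mul_le h
  have hlm4 : (PercRepro.Matroid.circuitsEq M 4).ncard ≤ lm5 (σ + t₂ + t₃ + t₄) 4 := by
    have h := PercRepro.Matroid.ncard_isCircuit_mul_choose_le M hR.subset hR.nonloop hR.cover hR.inj hν 4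
    rw [hRc, hc] at h
    exact le_lm5_of_mul_le h
  have hw3 : (PercRepro.Matroid.circuitsEq M 3).ncard ≤ σ.choose 3 + σ * t₂ + t₃ :=
    (ncard_circuitsEq_le_card_weight hcoloop hR hRfin 3).trans (card_weight_three_le Rf a h1)
  have hw4 : (PercRepro.Matroid.circuitsEq M 4).ncard ≤
      σ.choose 4 + σ.choose 2 * t₂ + t₂.choose 2 + σ * t₃ + t₄ :=
    (ncard_circuitsEq_le_card_weight hcoloop hR hRfin 4).trans (card_weight_four_le Rf a h1)
  have hs₃ : (PercRepro.Matroid.circuitsEq M 3).ncard ≤ bound3five σ t₂ t₃ t₄ :=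
    le_min hs25 (le_min hlm3 hw3)
  have hs₄ : (PercRepro.Matroid.circuitsEq M 4).ncard ≤ bound4five σ t₂ t₃ t₄ :=
    le_min hs70 (le_min hlm4 hw4)
  exact rls_of_cellOK5 M p hp hs hC1 hC2 hcoloop hrank hE hs₃ hs₄
    (table_dense5 (p + 5) (by omega) (by omega) σ t₂ t₃ t₄ hn.symm)

/-! ### The cells `9 ≤ p ≤ 13` at corank `5` -/

/-- **C-025 at `(p, 3)` on the coloop-free core at corank `5` for every `9 ≤ p ≤ 13`.** -/
theorem c025_core_five_small (M : Matroid α) [M.Finite] (p : ℕ) (hp : 9 ≤ p) (hp' : p ≤ 13)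
    (hs : ∀ e ∈ M.E, ∀ f ∈ M.E, e ≠ f → M.eRk {e, f} = 2) (hcoloop : ∀ e, ¬ M.IsColoop e)
    (hfree : ∀ e ∈ M.E, ∃ A ⊆ M.E \ {e}, e ∉ M.closure A ∧ e ∉ M.closure ((M.E \ {e}) \ A))
    (hrank : M.eRank = (p : ℕ∞)) (hE : M.E.ncard = p + 5) : ThmN.RLS M p 3 := by
  have hd : M.E.encard = M.eRank + 5 := by
    rw [hrank, ← M.ground_finite.cast_ncard_eq, hE]; push_cast; rfl
  set S₀ := ⋃₀ PercRepro.Matroid.circuitsLE M 4 with hS₀def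
  have hS₀E : S₀ ⊆ M.E := sUnion_circuitsLE_subset_ground M 4
  have hS₀fin : S₀.Finite := M.ground_finite.subset hS₀E
  obtain ⟨r, hr⟩ := exists_eRk_eq_nat (M := M) S₀
  have hrle : r ≤ S₀.ncard := by
    have := M.eRk_le_encard S₀
    rw [hr, ← hS₀fin.cast_ncard_eq] at this
    exact_mod_cast this
  have hd' : S₀.encard = M.eRk S₀ + ((S₀.ncard - r : ℕ) : ℕ∞) := by
    rw [hr, ← hS₀fin.cast_ncard_eq]
    have : S₀.ncard = r + (S₀.ncard - r) := by omega
    conv_lhs => rw [this]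
    push_cast; rfl
  have hmono := encard_le_eRk_add_of_ground hS₀E hd
  rw [hd'] at hmono
  have hle5 : S₀.ncard - r ≤ 5 := by
    have h := (WithTop.add_le_add_iff_left (by rw [hr]; exact WithTop.natCast_ne_top r)).1 hmono
    have h' : ((S₀.ncard - r : ℕ) : ℕ∞) ≤ ((5 : ℕ) : ℕ∞) := h
    exact_mod_cast h'
  rcases Nat.lt_or_ge (S₀.ncard - r) 5 with hlt | hge
  · exact rls_five_of_nullity_le_four M p hp hp' hs hfree hcoloop hrank hE hd' (by omega)
  · have h5 : S₀.ncard - r = 5 := by omega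
    rw [h5] at hd'
    have hS₀ : S₀ = M.E := eq_ground_of_encard_eq_eRk_add hcoloop hS₀E hd hd'
    exact rls_five_of_dense M p hp hp' hs hfree hcoloop hrank hE hS₀

/-- **The small core cells without corank `4` below `p = 18` and without corank `5` below `p = 14`.** -/
def SmallCoreCellsSix : Prop :=
  ∀ {α : Type} (M : Matroid α) [M.Finite] (p : ℕ), 5 ≤ p →
    (∀ e ∈ M.E, ∀ f ∈ M.E, e ≠ f → M.eRk {e, f} = 2) → M.eRank = (p : ℕ∞) →
    (∀ e, ¬ M.IsColoop e) →
    (∀ e ∈ M.E, ∃ A ⊆ M.E \ {e}, e ∉ M.closure A ∧ e ∉ M.closure ((M.E \ {e}) \ A)) →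
    ((p = 7 ∨ p = 8) ∨
      (p ≤ 169 ∧ p + 4 ≤ M.E.ncard ∧ M.E.ncard < p + CoreRegimes.amin p ∧
        ¬ (M.E.ncard = p + 4 ∧ 100 ≤ M.E.ncard) ∧ ¬ (M.E.ncard = p + 4 ∧ 9 ≤ p ∧ p ≤ 17) ∧
        ¬ (M.E.ncard = p + 5 ∧ 9 ≤ p ∧ p ≤ 13))) →
    ThmN.RLS M p 3

/-- The cells of `SmallCoreCells''''` outside `SmallCoreCellsSix` are the corank-`5` cells `9 ≤ p ≤ 13`. -/
theorem smallCoreCells''''_of_six (h : SmallCoreCellsSix) : SmallCoreCells'''' := by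
  intro α M _ p hp hs hrank hcoloop hfree hcell
  rcases hcell with h78 | ⟨hp169, hlo, hhi, h100, h4⟩
  · exact h M p hp hs hrank hcoloop hfree (Or.inl h78)
  · by_cases h5 : M.E.ncard = p + 5 ∧ 9 ≤ p ∧ p ≤ 13
    · exact c025_core_five_small M p h5.2.1 h5.2.2 hs hcoloop hfree hrank h5.1
    · exact h M p hp hs hrank hcoloop hfree (Or.inr ⟨hp169, hlo, hhi, h100, h4, h5⟩)

/-- **C-025 at `q = 3` for every finite matroid and every `p ≥ 5`, from the cells of `SmallCoreCellsSix`.** -/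
theorem c025_three_of_smallCoreCellsSix (h : SmallCoreCellsSix) :
    ∀ {α : Type} (M : Matroid α) [M.Finite] (p : ℕ), 5 ≤ p → ThmN.RLS M p 3 :=
  c025_three_of_smallCoreCells'''' (smallCoreCells''''_of_six h)

end CoreFour
end PercRepro
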